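import Literature.MathematicalPhysics.QuantumFieldTheory.MullerSchiemann1987.MS87WilsonAction
import HarnessLib

/-!
# Müller–Schiemann, *Continuum limit of a hierarchical SU(2) lattice gauge theory in 4 dimensions*
# (CMP 110, 1987), APPENDIX p.285 L.31–40: «Part (iv) of the lemma directly entails the induction assumption
# (A₂) for g̃(u, z), (2.21), using Proposition 1 to represent g̃ by h» — THE NONPERTURBATIVE BOUND (A₂) FOR THE
# HEAT-KERNEL ACTION from the tree's Lemma (iv), with the printed branch bookkeeping of the complex central angle,
# and Theorem 2 part 3) at the initial scale for (HK) — PROVED (theorems only; no definition, no named fact)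

statement-level skeleton of published theorems with citation tags; proofs where landed; nothing here is a claim about the Yang–Mills mass gap

**Citation header (reproduction of PUBLISHED work).** V. F. Müller, J. Schiemann, *Continuum limit of a hierarchical
SU(2) lattice gauge theory in 4 dimensions*, Commun. Math. Phys. **110** (1987) 261–286, doi 10.1007/BF01207367
[MullerSchiemann1987]; Proposition 1 with (2.13)–(2.15) p.264–265 and the Remark p.265, (2.18) p.265, (A₂) p.267,
Theorem 2 part 3) and (6.15) p.281, Appendix Lemma (iv) p.284 and p.285 L.31–40 with (A.12) (held Project Euclid
scan `paper:url-96df5da18d4c`; displays read by this seat on its own 3× page renders `run/shared/lean/pub/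
lit-balaban/lit-balaban-p12/renders-cmp110ms/ms87-cmp110-pdfp004,005,007,021,024,025-journalp264,265,267,281,284,
285-x3.png`). Lean lane of the lit-balaban YM LIT SWEEP CONTEXT row X1 (register level; zero weight for any token of
that table); the model is the `d = 4` HIERARCHICAL `SU(2)` gauge model, NOT lattice Yang–Mills.

**What the paper prints (p.285 L.31–40).** *«Part (iv) of the lemma directly entails the induction assumption (A₂)
for g̃(u, z), (2.21), using Proposition 1 to represent g̃ by h. We have to consider arguments (u, iy) with
u ∈ G∖𝒢[iy, β^{−α}], |y| < (κ/2)β^{−α}. (A.12) For u₀ ≤ 0 we have g̃(u, iy) = h(π − θ̌(u, iy)) with θ̌ defined in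
Sect. 2. We observe that |Im θ̌| ≤ |y| and 0 ≤ Re θ̌ ≤ π/2, which is implied by the remark following the proof of
Proposition 1; thus π − θ̌ is in the domain considered in (iv). For u₀ > 0 and |θ(u, iy)| > β^{−α} we have
g̃(u, iy) = h(θ(u, iy)), bounded by (iv), too. Both pieces together establish the bound (A₂).»*; Lemma (iv) p.284:
*«For β^{−α} < |θ|, 0 < α < ½, and |Re θ| ≤ π, |Im θ| < (κ/2)β^{−α}, κ² < 3/2: |h(θ)| < exp{β(Im θ)² − ⅝β^{1−2α}},
if β is sufficiently large»* (the tree's `HeatKernel.lemma_iv`, with `β = γ − 1/6 + ρ₁(γ) = betaIV γ`); (2.18) p.265: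
*«𝒢[z, ϱ] := {u ∈ G : u₀ > 0 and |θ²(u, z)| < ϱ²}»*; Theorem 2 part 3) p.281: *«For z = x + iy, with x, y ∈ ℝ,
|z| > (β_N^{(−n)})^{−α}, |x| ≤ π, |y| < (κ/2)(β_N^{(−n)})^{−α}, |h_N^{(−n)}(z)| < exp{β_N^{(−n)}y² − p(β_N^{(−n)})^{1−2α}}»*
with its proof (6.15) `h(z) = g̃(e₀, z) = g̃(e^{−ixσ₃}, iy)`.

**What this file proves (kernel-checked, 0 sorry, standard axioms; no definition, no named fact).** `g̃_HK`, `h`,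
`β(γ)` are the siblings' `HeatKernel.gTildeHK`, `HeatKernel.hC`, `HeatKernel.betaIV`; `θ², θ̌², η, η̌, f` are
`CentralAngle.thetaSq/thetaCheckSq/etaOf/etaCheckOf/fC`; `𝒢[z, ϱ]` is `Theorem2Part3.regionG`.
* §1 `|f(η)| ≤ |η|/(1 − |η|)` for `|η| < 1` (`norm_fC_le`, the majorant series with coefficients `≤ 1`), hence
  `|θ|² ≤ 4|η|/(1 − |η|)` for any `θ` with `θ² = 4f(η)` (`norm_sq_le_of_sq_eq`).
* §2 `η̌(u, iy)`: `Re η̌ = ½(1 + u₀ cosh y)`, `Im η̌ = ½u₃ sinh y`, `|η̌(u, iy)| ≤ ½[(1 + u₀) + (cosh y − 1)]`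
  (`norm_etaCheckOf_mul_I_le`; the `η`-twin is the sibling `WilsonAction.norm_etaOf_mul_I_le`); for `|y| ≤ ¼` both
  `|η(u, iy)|` (`u₀ > 0`) and `|η̌(u, iy)|` (`u₀ ≤ 0`) are `≤ 17/32`, so `|θ|², |θ̌|² ≤ 68/15 < π²`
  (`norm_theta_lt_pi`, `norm_thetaCheck_lt_pi`): the square roots lie in Lemma (iv)'s `|Re θ| ≤ π`.
* §3 square roots with `Re ≥ 0` exist (`exists_sq_eq_re_nonneg`), and **«0 ≤ Re θ̌ ≤ π/2» for `u₀ ≤ 0`**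
  (`re_thetaCheck_le_pi_div_two`: `cos θ̌ = 1 − 2η̌ = −u₀ cosh y − iu₃ sinh y` has `Re ≥ 0`, so `cos(Re θ̌) ≥ 0`, and
  `|θ̌| < π`); «|Im θ̌| ≤ |y|» is the sibling `CentralAngle.abs_im_le_of_thetaCheckSq`.
* §4 **(A₂) FOR THE HEAT-KERNEL ACTION** (`A2_heatKernel`): for `0 < α < ½`, `κ² < 3/2` there is `γ₀` such that for
  all `γ ≥ γ₀` (then `β = betaIV γ ≥ 1`), all real `y` with `|y| < (κ/2)β^{−α}` and all `u ∈ SU(2)` with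
  `u₀ ≤ 0` OR `|θ²(u, iy)| > β^{−2α}` (the two printed pieces; in particular `u ∉ 𝒢[iy, β^{−α}]`, `pieces_not_mem_regionG`):
  **`|g̃_HK(u, iy)| < exp{βy² − ⅝β^{1−2α}}`** — piece `u₀ ≤ 0` through `h(π − θ̌)` (`prop1_heatKernel_check_of_small`),
  piece `u₀ > 0` through `h(θ)` (`prop1_heatKernel_of_small`), both bounded by `lemma_iv` and `(Im θ)² ≤ y²`.
* §5 **THEOREM 2 PART 3) FOR (HK) AT THE INITIAL SCALE, AS PRINTED (`|z| > β^{−α}`)** (`thm2_part3_heatKernel`): for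
  `γ ≥ γ₀`, `z = x + iy` with `β^{−α} < |z| < 1` and `|y| < (κ/2)β^{−α}`: `|h(z)| < exp{βy² − ⅝β^{1−2α}}` — (6.15)
  `h(z) = g̃_HK(e^{−ixσ₃}, iy)` (siblings `gTildeHK_one`, `gTildeHK_diagPhase_mul`) and `|θ²(e^{−ixσ₃}, iy)| = |z|²`
  (sibling `Theorem2Part3.norm_thetaSq_diagPhase`).

**Readings / scope (declared).** (i) The complement of (2.18) is `u₀ ≤ 0 ∨ |θ²(u, iy)| ≥ β^{−2α}`; the paper's
second piece (p.285 L.37–38) and Lemma (iv) are printed with the STRICT `|θ(u, iy)| > β^{−α}`, and so is this file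
(the boundary `|θ| = β^{−α}` is not treated, exactly as in print; Theorem 2 part 3) is printed with `|z| > β^{−α}`
and is obtained in that form). (ii) `p = ⅝` and `κ² < 3/2` are Lemma (iv)'s constants (`½ < ⅝ < 1 − κ²/4` there);
«β sufficiently large» is `γ ≥ γ₀` with `β = betaIV γ → ∞` (`tendsto_betaIV_atTop`), `γ₀` also absorbing
`(κ/2)β^{−α} ≤ ¼` (so `|iy| < ¼`, the domain of the sibling's Proposition 1 lemmas) and `β ≥ 1`. (iii) «Re θ̌ ≥ 0»
is the choice of the square root (main branch); evenness/periodicity of `h` make the value independent of it.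

**Not claimed.** Theorem 1; (A₂) at later scales (that is Sect. 5); the boundary case `|θ(u, iy)| = β^{−α}`;
anything about lattice Yang–Mills or the Clay problem.
-/

noncomputable section

open Complex Set Filter
open scoped Real Topology

namespace Literature.MathematicalPhysics.QuantumFieldTheory

namespace MullerSchiemann1987

namespace HeatKernelA2

open HeatKernel (u0 u3 diagPhase hC gTildeHK betaIV lemma_iv tendsto_betaIV_atTop u0_sq_add_u3_sq_le_one
  abs_u0_le_one gTildeHK_one gTildeHK_diagPhase_mul)
open CentralAngle (fC fA etaOf etaCheckOf thetaSq thetaCheckSq norm_fC_term_le summable_fC_term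
  cos_eq_one_sub_two_mul prop1_heatKernel_of_small prop1_heatKernel_check_of_small abs_im_le_of_thetaSq
  abs_im_le_of_thetaCheckSq norm_etaOf_lt_one norm_etaCheckOf_lt_one)
open Theorem2Part3 (regionG mem_regionG norm_thetaSq_diagPhase)
open WilsonAction (norm_etaOf_mul_I_le)

/-! ## §1 `|f(η)| ≤ |η|/(1 − |η|)` and `|θ|² ≤ 4|η|/(1 − |η|)` -/

/-- `|f(η)| ≤ |η|/(1 − |η|)` for `|η| < 1`: the power series (2.15) `f(η) = Σ a_n η^{n+1}` has `0 < a_n ≤ 1`.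
[cite: MullerSchiemann1987, (2.15) p.265] -/
theorem norm_fC_le {η : ℂ} (hη : ‖η‖ < 1) : ‖fC η‖ ≤ ‖η‖ / (1 - ‖η‖) := by
  have hg : Summable fun n : ℕ => ‖η‖ * ‖η‖ ^ n := (summable_geometric_of_lt_one (norm_nonneg _) hη).mul_left _
  have hle : ∀ n : ℕ, ‖(fA n : ℂ) * η ^ (n + 1)‖ ≤ ‖η‖ * ‖η‖ ^ n := fun n => by
    rw [← pow_succ']; exact norm_fC_term_le η n
  have hnorm : Summable fun n : ℕ => ‖(fA n : ℂ) * η ^ (n + 1)‖ :=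
    Summable.of_nonneg_of_le (fun _ => norm_nonneg _) hle hg
  calc ‖fC η‖ = ‖∑' n : ℕ, (fA n : ℂ) * η ^ (n + 1)‖ := rfl
    _ ≤ ∑' n : ℕ, ‖(fA n : ℂ) * η ^ (n + 1)‖ := norm_tsum_le_tsum_norm hnorm
    _ ≤ ∑' n : ℕ, ‖η‖ * ‖η‖ ^ n := hnorm.tsum_le_tsum hle hg
    _ = ‖η‖ * (1 - ‖η‖)⁻¹ := by rw [tsum_mul_left, tsum_geometric_of_lt_one (norm_nonneg _) hη]
    _ = ‖η‖ / (1 - ‖η‖) := by rw [div_eq_mul_inv]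

/-- `|θ|² ≤ 4|η|/(1 − |η|)` for any `θ` with `θ² = 4f(η)`, `|η| < 1` ((2.13): `θ² = 4f(η)`). [cite: MullerSchiemann1987,
(2.13) p.264, (2.15) p.265] -/
theorem norm_sq_le_of_sq_eq {η θ : ℂ} (hη : ‖η‖ < 1) (h : θ ^ 2 = 4 * fC η) :
    ‖θ‖ ^ 2 ≤ 4 * (‖η‖ / (1 - ‖η‖)) := by
  rw [← norm_pow, h, norm_mul, Complex.norm_ofNat]
  exact mul_le_mul_of_nonneg_left (norm_fC_le hη) (by norm_num)

/-- From `|η| ≤ 17/32`: `|θ| < π` for `θ² = 4f(η)` (`4·(17/32)/(15/32) = 68/15 < 9 < π²`). [cite: MullerSchiemann1987,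
Remark p.265 («0 ≤ Re θ(u, z) < ⅚π»), Appendix Lemma (iv) p.284 («|Re θ| ≤ π»)] -/
theorem norm_lt_pi_of_norm_eta_le {η θ : ℂ} (hη : ‖η‖ ≤ 17 / 32) (h : θ ^ 2 = 4 * fC η) : ‖θ‖ < π := by
  have hη1 : ‖η‖ < 1 := by linarith
  have h1 := norm_sq_le_of_sq_eq hη1 h
  have h2 : ‖η‖ / (1 - ‖η‖) ≤ 17 / 15 := by
    rw [div_le_iff₀ (by linarith)]
    linarith
  have h3 : ‖θ‖ ^ 2 < π ^ 2 := by nlinarith [Real.pi_gt_three]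
  exact lt_of_pow_lt_pow_left₀ 2 Real.pi_pos.le h3

/-! ## §2 `η̌(u, iy)` on the imaginary axis and the bounds `|η|, |η̌| ≤ 17/32` for `|y| ≤ ¼` -/

/-- `Re η̌(u, iy) = ½(1 + u₀ cosh y)`. [cite: MullerSchiemann1987, (2.14) p.264] -/
theorem etaCheckOf_mul_I_re (U : Matrix.specialUnitaryGroup (Fin 2) ℂ) (t : ℝ) :
    (etaCheckOf U ((t : ℂ) * I)).re = (1 + u0 U * Real.cosh t) / 2 := by
  rw [CentralAngle.etaCheckOf, Complex.cos_mul_I, Complex.sin_mul_I]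
  simp [Complex.cosh_ofReal_re, Complex.sinh_ofReal_re, Complex.cosh_ofReal_im, Complex.sinh_ofReal_im]

/-- `Im η̌(u, iy) = ½u₃ sinh y`. [cite: MullerSchiemann1987, (2.14) p.264] -/
theorem etaCheckOf_mul_I_im (U : Matrix.specialUnitaryGroup (Fin 2) ℂ) (t : ℝ) :
    (etaCheckOf U ((t : ℂ) * I)).im = (u3 U * Real.sinh t) / 2 := by
  rw [CentralAngle.etaCheckOf, Complex.cos_mul_I, Complex.sin_mul_I]
  simp [Complex.cosh_ofReal_re, Complex.sinh_ofReal_re, Complex.cosh_ofReal_im, Complex.sinh_ofReal_im]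

/-- **`|η̌(u, iy)| ≤ ½[(1 + u₀) + (cosh y − 1)]`**: `4|η̌|² = (1 + u₀ cosh y)² + u₃² sinh² y ≤ (cosh y + u₀)²`
(`u₀² + u₃² ≤ 1`, `cosh² − sinh² = 1`). [cite: MullerSchiemann1987, (2.14) p.264, p.285 L.34–36] -/
theorem norm_etaCheckOf_mul_I_le (U : Matrix.specialUnitaryGroup (Fin 2) ℂ) (y : ℝ) :
    ‖etaCheckOf U ((y : ℂ) * I)‖ ≤ ((1 + u0 U) + (Real.cosh y - 1)) / 2 := by
  have hu := u0_sq_add_u3_sq_le_one U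
  have hu0 := abs_le.mp (abs_u0_le_one U)
  have hch : 1 ≤ Real.cosh y := Real.one_le_cosh y
  have hcs : Real.cosh y ^ 2 = Real.sinh y ^ 2 + 1 := Real.cosh_sq y
  have hnn : 0 ≤ ((1 + u0 U) + (Real.cosh y - 1)) / 2 := by linarith [hu0.1]
  have hsq : ‖etaCheckOf U ((y : ℂ) * I)‖ ^ 2 ≤ (((1 + u0 U) + (Real.cosh y - 1)) / 2) ^ 2 := by
    rw [← Complex.normSq_eq_norm_sq, Complex.normSq_apply, etaCheckOf_mul_I_re, etaCheckOf_mul_I_im]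
    have h3 : u3 U ^ 2 * Real.sinh y ^ 2 ≤ (1 - u0 U ^ 2) * Real.sinh y ^ 2 :=
      mul_le_mul_of_nonneg_right (by linarith) (sq_nonneg _)
    nlinarith [h3, hcs]
  exact (pow_le_pow_iff_left₀ (norm_nonneg _) hnn two_ne_zero).mp hsq

/-- `cosh t − 1 ≤ t²` for `|t| ≤ 1`. [folklore] -/
private theorem cosh_sub_one_le_sq {t : ℝ} (ht : |t| ≤ 1) : Real.cosh t - 1 ≤ t ^ 2 := by
  have h1 := Real.abs_exp_sub_one_sub_id_le ht
  have h2 := Real.abs_exp_sub_one_sub_id_le (show |-t| ≤ 1 by rwa [abs_neg])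
  rw [Real.cosh_eq]
  have := (abs_le.mp h1).2; have := (abs_le.mp h2).2
  nlinarith

/-- For `|y| ≤ ¼` and `u₀ > 0`: `|η(u, iy)| ≤ 17/32`. [cite: MullerSchiemann1987, (2.13) p.264, p.285 L.37–38] -/
theorem norm_etaOf_mul_I_le_of_pos (U : Matrix.specialUnitaryGroup (Fin 2) ℂ) {y : ℝ} (hy : |y| ≤ 1 / 4)
    (hU : 0 < u0 U) : ‖etaOf U ((y : ℂ) * I)‖ ≤ 17 / 32 := by
  have h1 := norm_etaOf_mul_I_le U y
  have h2 : Real.cosh y - 1 ≤ y ^ 2 := cosh_sub_one_le_sq (by linarith)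
  have h3 : y ^ 2 ≤ 1 / 16 := by
    have h := mul_self_le_mul_self (abs_nonneg y) hy
    rw [abs_mul_abs_self] at h
    nlinarith
  linarith

/-- For `|y| ≤ ¼` and `u₀ ≤ 0`: `|η̌(u, iy)| ≤ 17/32`. [cite: MullerSchiemann1987, (2.14) p.264, p.285 L.34–36] -/
theorem norm_etaCheckOf_mul_I_le_of_nonpos (U : Matrix.specialUnitaryGroup (Fin 2) ℂ) {y : ℝ} (hy : |y| ≤ 1 / 4)
    (hU : u0 U ≤ 0) : ‖etaCheckOf U ((y : ℂ) * I)‖ ≤ 17 / 32 := by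
  have h1 := norm_etaCheckOf_mul_I_le U y
  have h2 : Real.cosh y - 1 ≤ y ^ 2 := cosh_sub_one_le_sq (by linarith)
  have h3 : y ^ 2 ≤ 1 / 16 := by
    have h := mul_self_le_mul_self (abs_nonneg y) hy
    rw [abs_mul_abs_self] at h
    nlinarith
  linarith

/-- Main branch, `u₀ > 0`, `|y| ≤ ¼`: any `θ` with `θ² = θ²(u, iy)` has `|θ| < π` (so `|Re θ| ≤ π`).
[cite: MullerSchiemann1987, Remark p.265, p.285 L.37–38] -/
theorem norm_theta_lt_pi {U : Matrix.specialUnitaryGroup (Fin 2) ℂ} {y : ℝ} {θ : ℂ} (hy : |y| ≤ 1 / 4)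
    (hU : 0 < u0 U) (hθ : θ ^ 2 = thetaSq U ((y : ℂ) * I)) : ‖θ‖ < π :=
  norm_lt_pi_of_norm_eta_le (norm_etaOf_mul_I_le_of_pos U hy hU) (by rw [hθ]; rfl)

/-- Complementary branch, `u₀ ≤ 0`, `|y| ≤ ¼`: any `θ̌` with `θ̌² = θ̌²(u, iy)` has `|θ̌| < π`.
[cite: MullerSchiemann1987, Remark p.265, p.285 L.34–36] -/
theorem norm_thetaCheck_lt_pi {U : Matrix.specialUnitaryGroup (Fin 2) ℂ} {y : ℝ} {θ : ℂ} (hy : |y| ≤ 1 / 4)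
    (hU : u0 U ≤ 0) (hθ : θ ^ 2 = thetaCheckSq U ((y : ℂ) * I)) : ‖θ‖ < π :=
  norm_lt_pi_of_norm_eta_le (norm_etaCheckOf_mul_I_le_of_nonpos U hy hU) (by rw [hθ]; rfl)

/-! ## §3 The square root with `Re ≥ 0` and «0 ≤ Re θ̌ ≤ π/2» for `u₀ ≤ 0` -/

/-- Every complex number has a square root with nonnegative real part («we take the main branch of the square
root in (2.13), (2.14)», Remark p.265). [cite: MullerSchiemann1987, Remark p.265] -/
theorem exists_sq_eq_re_nonneg (w : ℂ) : ∃ θ : ℂ, θ ^ 2 = w ∧ 0 ≤ θ.re := by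
  obtain ⟨θ₀, h⟩ := IsAlgClosed.exists_pow_nat_eq w (by norm_num : 0 < 2)
  by_cases h0 : 0 ≤ θ₀.re
  · exact ⟨θ₀, h, h0⟩
  · refine ⟨-θ₀, by rw [neg_sq, h], ?_⟩
    rw [Complex.neg_re]
    linarith

/-- Real part of the complex cosine: `Re cos(a + ib) = cos a cosh b`. [folklore] -/
private theorem cos_re_aux (z : ℂ) : (Complex.cos z).re = Real.cos z.re * Real.cosh z.im := by
  rw [Complex.cos_eq]
  simp [Complex.cos_ofReal_re, Complex.cosh_ofReal_re, Complex.sin_ofReal_re, Complex.sinh_ofReal_re,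
    Complex.cos_ofReal_im, Complex.cosh_ofReal_im, Complex.sin_ofReal_im, Complex.sinh_ofReal_im,
    Complex.mul_re, Complex.mul_im]

/-- **«Re θ̌ ≤ π/2» for `u₀ ≤ 0`** (p.285 L.34–36; «0 ≤ Re θ̌» is the choice of the branch): for ANY `θ̌` with
`θ̌² = θ̌²(u, iy)`, `|y| ≤ ¼`: `cos θ̌ = 1 − 2η̌(u, iy) = −u₀ cosh y − iu₃ sinh y` has real part
`cos(Re θ̌) cosh(Im θ̌) = −u₀ cosh y ≥ 0`, and `Re θ̌ ≤ |θ̌| < π`, hence `Re θ̌ ≤ π/2`. [cite: MullerSchiemann1987,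
p.285 L.34–36, Remark p.265] -/
theorem re_thetaCheck_le_pi_div_two {U : Matrix.specialUnitaryGroup (Fin 2) ℂ} {y : ℝ} {θ : ℂ} (hy : |y| ≤ 1 / 4)
    (hU : u0 U ≤ 0) (hθ : θ ^ 2 = thetaCheckSq U ((y : ℂ) * I)) : θ.re ≤ π / 2 := by
  have hη : ‖etaCheckOf U ((y : ℂ) * I)‖ < 1 := by
    have := norm_etaCheckOf_mul_I_le_of_nonpos U hy hU; linarith
  have hcos : Complex.cos θ = 1 - 2 * etaCheckOf U ((y : ℂ) * I) :=
    cos_eq_one_sub_two_mul hη (by rw [hθ]; rfl)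
  have h2re : ((2 : ℂ) * etaCheckOf U ((y : ℂ) * I)).re = 2 * (etaCheckOf U ((y : ℂ) * I)).re := by
    simp [Complex.mul_re]
  have hre_cos : (Complex.cos θ).re = -(u0 U * Real.cosh y) := by
    rw [hcos, Complex.sub_re, Complex.one_re, h2re, etaCheckOf_mul_I_re]
    ring
  have hcos_re : (Complex.cos θ).re = Real.cos θ.re * Real.cosh θ.im := cos_re_aux θ
  have hnn : 0 ≤ Real.cos θ.re * Real.cosh θ.im := by
    rw [← hcos_re, hre_cos]
    have : u0 U * Real.cosh y ≤ 0 := mul_nonpos_of_nonpos_of_nonneg hU (Real.cosh_pos y).le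
    linarith
  have hcosnn : 0 ≤ Real.cos θ.re :=
    nonneg_of_mul_nonneg_left hnn (Real.cosh_pos _)
  have hlt : θ.re < π := (Complex.re_le_norm θ).trans_lt (norm_thetaCheck_lt_pi hy hU hθ)
  by_contra hgt
  push Not at hgt
  have := Real.cos_neg_of_pi_div_two_lt_of_lt hgt (by linarith [Real.pi_pos])
  linarith

/-! ## §4 (A₂) for the heat-kernel action from Lemma (iv) -/

/-- The two printed pieces «u₀ ≤ 0» and «u₀ > 0 and |θ(u, iy)| > β^{−α}» lie in the complement of the small-field
region (2.18): such `u` are NOT in `𝒢[iy, β^{−α}]`. [cite: MullerSchiemann1987, (2.18) p.265, (A.12) p.285] -/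
theorem pieces_not_mem_regionG {U : Matrix.specialUnitaryGroup (Fin 2) ℂ} {z : ℂ} {ρ : ℝ}
    (h : u0 U ≤ 0 ∨ ρ ^ 2 < ‖thetaSq U z‖) : U ∉ regionG z ρ := by
  intro hmem
  rw [mem_regionG] at hmem
  rcases h with h | h
  · linarith [hmem.1]
  · linarith [hmem.2]

/-- «β sufficiently large»: eventually in `γ`, Lemma (iv) holds at `β = betaIV γ`, `β ≥ 1`, and the imaginary
arguments `|y| < (κ/2)β^{−α}` lie in `|y| < ¼`. [cite: MullerSchiemann1987, Appendix Lemma (iv) p.284 («if β is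
sufficiently large»), (3.4) p.266] -/
private theorem eventually_domain {α κ : ℝ} (hα0 : 0 < α) :
    ∃ γ₂ : ℝ, ∀ γ : ℝ, γ₂ ≤ γ → 1 ≤ betaIV γ ∧ κ / 2 * (betaIV γ) ^ (-α) < 1 / 4 := by
  have ev1 : ∀ᶠ γ : ℝ in atTop, 1 ≤ betaIV γ := tendsto_betaIV_atTop.eventually (eventually_ge_atTop 1)
  have h0 : Tendsto (fun γ : ℝ => κ / 2 * (betaIV γ) ^ (-α)) atTop (𝓝 (κ / 2 * 0)) :=
    ((tendsto_rpow_neg_atTop hα0).comp tendsto_betaIV_atTop).const_mul (κ / 2)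
  rw [mul_zero] at h0
  have ev2 : ∀ᶠ γ : ℝ in atTop, κ / 2 * (betaIV γ) ^ (-α) < 1 / 4 := h0.eventually (gt_mem_nhds (by norm_num))
  obtain ⟨γ₂, hγ₂⟩ := Filter.eventually_atTop.mp (ev1.and ev2)
  exact ⟨γ₂, hγ₂⟩

/-- **(A₂) FOR THE HEAT-KERNEL ACTION** (Appendix p.285 L.31–40 from Lemma (iv)): for `0 < α < ½` and `κ² < 3/2`
there is `γ₀` such that for every `γ ≥ γ₀` — with `β = betaIV γ = γ − 1/6 + ρ₁(γ) ≥ 1` — every real `y` with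
`|y| < (κ/2)β^{−α}` and every `u ∈ SU(2)` with `u₀ ≤ 0` or `|θ²(u, iy)| > β^{−2α}` (the two printed pieces of
`G∖𝒢[iy, β^{−α}]`): `|g̃_HK(u, iy)| < exp{βy² − ⅝β^{1−2α}}`. Piece `u₀ ≤ 0`: `g̃ = h(π − θ̌)` (Proposition 1),
`|Im θ̌| ≤ |y|`, `0 ≤ Re θ̌ ≤ π/2`, so `π − θ̌` is in Lemma (iv)'s domain (`|π − θ̌| ≥ π/2 > β^{−α}`); piece `u₀ > 0`:
`g̃ = h(θ)`, `|θ| > β^{−α}`, `|Re θ| ≤ |θ| < π`, `|Im θ| ≤ |y|`. [cite: MullerSchiemann1987, (A₂) p.267, Appendix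
p.285 L.31–40, Lemma (iv) p.284] -/
theorem A2_heatKernel {α κ : ℝ} (hα0 : 0 < α) (hα : α < 1 / 2) (hκ : κ ^ 2 < 3 / 2) :
    ∃ γ₀ : ℝ, ∀ γ : ℝ, γ₀ ≤ γ → 1 ≤ betaIV γ ∧
      ∀ y : ℝ, |y| < κ / 2 * (betaIV γ) ^ (-α) → ∀ U : Matrix.specialUnitaryGroup (Fin 2) ℂ,
        (u0 U ≤ 0 ∨ ((betaIV γ) ^ (-α)) ^ 2 < ‖thetaSq U ((y : ℂ) * I)‖) →
        ‖gTildeHK γ U ((y : ℂ) * I)‖ <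
          Real.exp (betaIV γ * y ^ 2 - 5 / 8 * (betaIV γ) ^ (1 - 2 * α)) := by
  obtain ⟨γ₁, hγ₁⟩ := lemma_iv hα0 hα hκ
  obtain ⟨γ₂, hγ₂⟩ := eventually_domain (κ := κ) hα0
  refine ⟨max γ₁ γ₂, fun γ hγ => ?_⟩
  have hL := hγ₁ γ ((le_max_left _ _).trans hγ)
  obtain ⟨hβ1, hdom⟩ := hγ₂ γ ((le_max_right _ _).trans hγ)
  refine ⟨hβ1, fun y hy U hU => ?_⟩
  set β : ℝ := betaIV γ with hβdef
  have hβ0 : 0 < β := by linarith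
  have hϱ0 : 0 < β ^ (-α) := Real.rpow_pos_of_pos hβ0 _
  have hϱ1 : β ^ (-α) ≤ 1 := Real.rpow_le_one_of_one_le_of_nonpos hβ1 (by linarith)
  have hy4 : |y| ≤ 1 / 4 := by linarith
  have hz : ‖(y : ℂ) * I‖ < 1 / 4 := by
    rw [norm_mul, Complex.norm_I, mul_one, Complex.norm_real, Real.norm_eq_abs]; linarith
  have hzim : (((y : ℂ) * I).im) = y := by simp
  -- the target bound from a bound with `(Im Θ)²`, `|Im Θ| ≤ |y|`
  have hmono : ∀ {Θ : ℂ}, |Θ.im| ≤ |y| →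
      Real.exp (β * Θ.im ^ 2 - 5 / 8 * β ^ (1 - 2 * α)) ≤ Real.exp (β * y ^ 2 - 5 / 8 * β ^ (1 - 2 * α)) := by
    intro Θ hΘ
    have h2 : Θ.im ^ 2 ≤ y ^ 2 := by
      have h := mul_self_le_mul_self (abs_nonneg _) hΘ
      rw [abs_mul_abs_self, abs_mul_abs_self] at h
      nlinarith
    exact Real.exp_le_exp.mpr (by nlinarith [mul_le_mul_of_nonneg_left h2 hβ0.le])
  rcases le_or_gt (u0 U) 0 with hU0 | hU0
  · -- piece `u₀ ≤ 0`: `g̃(u, iy) = h(π − θ̌(u, iy))`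
    obtain ⟨θ, hθ, hre⟩ := exists_sq_eq_re_nonneg (thetaCheckSq U ((y : ℂ) * I))
    have hP1 : gTildeHK γ U ((y : ℂ) * I) = hC γ (π - θ) :=
      prop1_heatKernel_check_of_small γ hz (by linarith) hθ
    have hηc : ‖etaCheckOf U ((y : ℂ) * I)‖ < 1 := norm_etaCheckOf_lt_one hz (by linarith)
    have him : |θ.im| ≤ |y| := by
      have := abs_im_le_of_thetaCheckSq hηc hθ; rwa [hzim] at this
    have hre2 : θ.re ≤ π / 2 := re_thetaCheck_le_pi_div_two hy4 hU0 hθ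
    -- `π − θ̌` is in the domain of Lemma (iv)
    have hΘre : (↑π - θ).re = π - θ.re := by simp
    have hΘim : (↑π - θ).im = -θ.im := by simp
    have h1 : β ^ (-α) < ‖(↑π - θ : ℂ)‖ := by
      have : π / 2 ≤ (↑π - θ : ℂ).re := by rw [hΘre]; linarith
      have h3 : (1 : ℝ) < π / 2 := by linarith [Real.pi_gt_three]
      exact lt_of_le_of_lt hϱ1 (lt_of_lt_of_le (lt_of_lt_of_le h3 this) (Complex.re_le_norm _))
    have h2 : |(↑π - θ : ℂ).re| ≤ π := by
      rw [hΘre, abs_le]; constructor <;> linarith [Real.pi_pos]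
    have h3 : |(↑π - θ : ℂ).im| < κ / 2 * β ^ (-α) := by
      rw [hΘim, abs_neg]; exact lt_of_le_of_lt him hy
    have h4 := hL (↑π - θ) h1 h2 h3
    rw [hP1]
    refine lt_of_lt_of_le h4 (hmono ?_)
    rw [hΘim, abs_neg]; exact him
  · -- piece `u₀ > 0`, `|θ(u, iy)| > β^{−α}`: `g̃(u, iy) = h(θ(u, iy))`
    have hsq : (β ^ (-α)) ^ 2 < ‖thetaSq U ((y : ℂ) * I)‖ := by
      rcases hU with h | h
      · exact absurd h (not_le.mpr hU0)
      · exact h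
    obtain ⟨θ, hθ, -⟩ := exists_sq_eq_re_nonneg (thetaSq U ((y : ℂ) * I))
    have hP1 : gTildeHK γ U ((y : ℂ) * I) = hC γ θ := prop1_heatKernel_of_small γ hz (by linarith) hθ
    have hη : ‖etaOf U ((y : ℂ) * I)‖ < 1 := norm_etaOf_lt_one hz (by linarith)
    have him : |θ.im| ≤ |y| := by
      have := abs_im_le_of_thetaSq hη hθ; rwa [hzim] at this
    have h1 : β ^ (-α) < ‖θ‖ := by
      have : (β ^ (-α)) ^ 2 < ‖θ‖ ^ 2 := by rw [← norm_pow, hθ]; exact hsq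
      exact lt_of_pow_lt_pow_left₀ 2 (norm_nonneg _) this
    have h2 : |θ.re| ≤ π := (Complex.abs_re_le_norm θ).trans (norm_theta_lt_pi hy4 hU0 hθ).le
    have h3 : |θ.im| < κ / 2 * β ^ (-α) := lt_of_le_of_lt him hy
    have h4 := hL θ h1 h2 h3
    rw [hP1]
    exact lt_of_lt_of_le h4 (hmono him)

/-! ## §5 Theorem 2 part 3) for the heat-kernel action at the initial scale, as printed (`|z| > β^{−α}`) -/

/-- **THEOREM 2 PART 3) FOR (HK) AT THE INITIAL SCALE**: for `0 < α < ½`, `κ² < 3/2` and `γ ≥ γ₀` (`β = betaIV γ`):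
for `z = x + iy` with `β^{−α} < |z| < 1` and `|y| < (κ/2)β^{−α}`, `|h(z)| < exp{βy² − ⅝β^{1−2α}}` — (6.15)
`h(z) = g̃_HK(e₀, z) = g̃_HK(e^{−ixσ₃}, iy)` and `|θ²(e^{−ixσ₃}, iy)| = |z|² > β^{−2α}`, then §4.
[cite: MullerSchiemann1987, Thm 2 part 3) and (6.15) p.281, (A₂) p.267, Appendix p.285 L.31–40] -/
theorem thm2_part3_heatKernel {α κ : ℝ} (hα0 : 0 < α) (hα : α < 1 / 2) (hκ : κ ^ 2 < 3 / 2) :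
    ∃ γ₀ : ℝ, ∀ γ : ℝ, γ₀ ≤ γ → ∀ x y : ℝ,
      (betaIV γ) ^ (-α) < ‖(x : ℂ) + y * I‖ → ‖(x : ℂ) + y * I‖ < 1 → |y| < κ / 2 * (betaIV γ) ^ (-α) →
        ‖hC γ ((x : ℂ) + y * I)‖ < Real.exp (betaIV γ * y ^ 2 - 5 / 8 * (betaIV γ) ^ (1 - 2 * α)) := by
  obtain ⟨γ₀, hγ₀⟩ := A2_heatKernel hα0 hα hκ
  refine ⟨γ₀, fun γ hγ x y hz1 hz2 hy => ?_⟩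
  obtain ⟨hβ1, hA2⟩ := hγ₀ γ hγ
  have h615 : hC γ ((x : ℂ) + y * I) = gTildeHK γ (diagPhase x) ((y : ℂ) * I) := by
    rw [← gTildeHK_one, ← gTildeHK_diagPhase_mul γ x 1 ((y : ℂ) * I), mul_one]
  rw [h615]
  refine hA2 y hy (diagPhase x) (Or.inr ?_)
  rw [norm_thetaSq_diagPhase x y hz2]
  have h0 : 0 ≤ (betaIV γ) ^ (-α) := Real.rpow_nonneg (by linarith) _
  exact pow_lt_pow_left₀ hz1 h0 two_ne_zero

end HeatKernelA2

end MullerSchiemann1987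

end Literature.MathematicalPhysics.QuantumFieldTheory
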